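import Summits.MatrixMultiplication.OmegaCensus.DominoPartSevenZ4Z4
import Summits.MatrixMultiplication.OmegaCensus.DominoPartFiveZ4Z4Cells
import Summits.MatrixMultiplication.OmegaCensus.DihedralLawModOneZ4Z4Five
import HarnessLib

/-!
# The part-`7` domino cells over `A ↠ ℤ₄ × ℤ₄`: TPP statements, the order `400`, census cells

ω-census `pub-omega`, family (b3), seat pub-omega-group gen 16.  Framing: lottery ticket; floor = certified bounds/negative
ranges.  VALUE: kernel theorems about the group-theoretic method (TPP capacity of dihedral-like groups) closing census cells;
NOT progress on ω.

From `no_shifted_form_seven_of_onto_z4z4` (`DominoPartSevenZ4Z4.lean`):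
* `no_law_cube_17e_of_onto_z4z4`, `no_law_cube_1d7_of_onto_z4z4` — dihedral-like `G` over `A ↠ ℤ₄²` (any `c₀`): no TPP
  triple with coset parts `(1,1 | 7,7 | e,e)` resp. `(1,1 | d,d | 7,7)` attains `3|S||T||U| + 8 = 8|A|`;
  `no_law_cube_one_seven_of_onto_z4z4` — the cell form (balanced parts, a part `1` and a part `7` in any positions), and
  `no_law_cube_one_three_of_onto_z4z4` — the same packaging of gen 14's part-`3` theorem;
* `no_mod_one_law_of_onto_z4z4_seven` — the assembly: no law over `A ↠ ℤ₄²` whenever every factorisation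
  `cde = (|A|−1)/3` has two parts `1` or a part `1` together with a part `3`, `5` or `7`;
* the ORDER `400` (`(400−1)/3 = 133 = 7·19`): `no_mod_one_law_card_400_of_onto_z4z4` and the instances
  **`no_mod_one_law_z4_z4_z25`, `no_mod_one_law_z4_z4_z5_z5`** — census cells `(1,7,19)` at `400` for `ℤ₄²×ℤ₂₅`, `ℤ₄²×ℤ₅²`
  (open after gen 7; exact ×1 by gen 14) are KERNEL, and with `no_mod_one_law_of_rank_three` every abelian group of order
  `400` containing `ℤ₄²` or of `2`-rank `≥ 3` is law-free (the two groups `ℤ₅²×ℤ₁₆`, `ℤ₂×ℤ₅²×ℤ₈` with `ℤ₅²`-quotient only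
  remain engine-level);
* the cell `(1,7,35)` at `736` (`A = ℤ₄×ℤ₈×ℤ₂₃`): `z4_z8_z23_no_law_cube_one_seven`.
-/

namespace Summit.MatrixMultiplication.OmegaCensus

open Finset

section DihedralLike

variable {A : Type} [AddCommGroup A] [DecidableEq A] [Fintype A] {G : Type} [Group G] [DecidableEq G]
  {ρ τ : A → G} {c₀ : A} {S T U : Finset G}

open Literature.Combinatorics.Additive

/-- **No `(1,1 | 7,7 | e,e)` law triple over `A ↠ ℤ₄ × ℤ₄`.**  Dihedral-like `G` over `A` (any `c₀`), `φ : A →+ ZMod 4 × ZMod 4`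
onto; a TPP triple whose coset parts have sizes `|S₀| = |S₁| = 1`, `|T₀| = |T₁| = 7`, `|U₀| = |U₁|`.  Then
`3|S||T||U| + 8 ≠ 8|A|`. [folklore] -/
theorem no_law_cube_17e_of_onto_z4z4
    (hρρ : ∀ a b, ρ a * ρ b = ρ (a + b)) (hρτ : ∀ a b, ρ a * τ b = τ (b - a))
    (hτρ : ∀ a b, τ a * ρ b = τ (a + b)) (hττ : ∀ a b, τ a * τ b = ρ (c₀ + b - a))
    (hρ : Function.Injective ρ) (hτ : Function.Injective τ) (hne : ∀ a b, ρ a ≠ τ b)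
    (hsurj : ∀ g, (∃ a, ρ a = g) ∨ (∃ a, τ a = g))
    (φ : A →+ ZMod 4 × ZMod 4) (hφ : Function.Surjective φ)
    (h : TripleProductProperty S T U)
    (hS₀ : (univ.filter fun a : A => ρ a ∈ S).card = 1) (hS₁ : (univ.filter fun a : A => τ a ∈ S).card = 1)
    (hT₀ : (univ.filter fun a : A => ρ a ∈ T).card = 7) (hT₁ : (univ.filter fun a : A => τ a ∈ T).card = 7)
    (hU : (univ.filter fun a : A => ρ a ∈ U).card = (univ.filter fun a : A => τ a ∈ U).card)
    (hV : 3 * (S.card * T.card * U.card) + 8 = 8 * Fintype.card A) : False := by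
  classical
  obtain ⟨X, Y, β, γ, x₀, hXc, -, hinj, hPQ, hPR, hQR, hcover⟩ :=
    domino_shifted_form_of_law hρρ hρτ hτρ hττ hρ hτ hne hsurj h hS₀ hS₁ (by rw [hT₀, hT₁]) hU hV
  rw [hT₀] at hXc
  exact no_shifted_form_seven_of_onto_z4z4 φ hφ hXc hinj hPQ hPR hQR hcover

/-- **No `(1,1 | d,d | 7,7)` law triple over `A ↠ ℤ₄ × ℤ₄`** (the size-`7` parts in `U`). [folklore] -/
theorem no_law_cube_1d7_of_onto_z4z4
    (hρρ : ∀ a b, ρ a * ρ b = ρ (a + b)) (hρτ : ∀ a b, ρ a * τ b = τ (b - a))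
    (hτρ : ∀ a b, τ a * ρ b = τ (a + b)) (hττ : ∀ a b, τ a * τ b = ρ (c₀ + b - a))
    (hρ : Function.Injective ρ) (hτ : Function.Injective τ) (hne : ∀ a b, ρ a ≠ τ b)
    (hsurj : ∀ g, (∃ a, ρ a = g) ∨ (∃ a, τ a = g))
    (φ : A →+ ZMod 4 × ZMod 4) (hφ : Function.Surjective φ)
    (h : TripleProductProperty S T U)
    (hS₀ : (univ.filter fun a : A => ρ a ∈ S).card = 1) (hS₁ : (univ.filter fun a : A => τ a ∈ S).card = 1)
    (hT : (univ.filter fun a : A => ρ a ∈ T).card = (univ.filter fun a : A => τ a ∈ T).card)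
    (hU₀ : (univ.filter fun a : A => ρ a ∈ U).card = 7) (hU₁ : (univ.filter fun a : A => τ a ∈ U).card = 7)
    (hV : 3 * (S.card * T.card * U.card) + 8 = 8 * Fintype.card A) : False := by
  classical
  obtain ⟨X, Y, β, γ, x₀, -, hYc, hinj, hPQ, hPR, hQR, hcover⟩ :=
    domino_shifted_form_of_law hρρ hρτ hτρ hττ hρ hτ hne hsurj h hS₀ hS₁ hT (by rw [hU₀, hU₁]) hV
  rw [hU₀] at hYc
  exact no_shifted_form_seven_of_onto_z4z4' φ hφ hYc hinj hPQ hPR hQR hcover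

/-- **No cube law triple with parts `1` and `7` over `A ↠ ℤ₄ × ℤ₄` (cell form).**  Balanced coset parts, one `ρ`-part of size
`1` and one of size `7`, in any of the three members: then `3|S||T||U| + 8 ≠ 8|A|`. [folklore] -/
theorem no_law_cube_one_seven_of_onto_z4z4
    (hρρ : ∀ a b, ρ a * ρ b = ρ (a + b)) (hρτ : ∀ a b, ρ a * τ b = τ (b - a))
    (hτρ : ∀ a b, τ a * ρ b = τ (a + b)) (hττ : ∀ a b, τ a * τ b = ρ (c₀ + b - a))
    (hρ : Function.Injective ρ) (hτ : Function.Injective τ) (hne : ∀ a b, ρ a ≠ τ b)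
    (hsurj : ∀ g, (∃ a, ρ a = g) ∨ (∃ a, τ a = g))
    (φ : A →+ ZMod 4 × ZMod 4) (hφ : Function.Surjective φ)
    (h : TripleProductProperty S T U)
    (hS : (univ.filter fun a : A => ρ a ∈ S).card = (univ.filter fun a : A => τ a ∈ S).card)
    (hT : (univ.filter fun a : A => ρ a ∈ T).card = (univ.filter fun a : A => τ a ∈ T).card)
    (hU : (univ.filter fun a : A => ρ a ∈ U).card = (univ.filter fun a : A => τ a ∈ U).card)
    (h1 : (univ.filter fun a : A => ρ a ∈ S).card = 1 ∨ (univ.filter fun a : A => ρ a ∈ T).card = 1 ∨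
      (univ.filter fun a : A => ρ a ∈ U).card = 1)
    (h7 : (univ.filter fun a : A => ρ a ∈ S).card = 7 ∨ (univ.filter fun a : A => ρ a ∈ T).card = 7 ∨
      (univ.filter fun a : A => ρ a ∈ U).card = 7) :
    3 * (S.card * T.card * U.card) + 8 ≠ 8 * Fintype.card A := by
  intro hV
  have hV_TUS : 3 * (T.card * U.card * S.card) + 8 = 8 * Fintype.card A := by
    rw [show T.card * U.card * S.card = S.card * T.card * U.card by ring]; exact hV
  have hV_UST : 3 * (U.card * S.card * T.card) + 8 = 8 * Fintype.card A := by
    rw [show U.card * S.card * T.card = S.card * T.card * U.card by ring]; exact hV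
  have hTUS : TripleProductProperty T U S := h.rotate
  have hUST : TripleProductProperty U S T := h.rotate.rotate
  rcases h1 with hs1 | ht1 | hu1 <;> rcases h7 with hs7 | ht7 | hu7
  · omega
  · exact no_law_cube_17e_of_onto_z4z4 hρρ hρτ hτρ hττ hρ hτ hne hsurj φ hφ h hs1 (hS ▸ hs1) ht7 (hT ▸ ht7) hU hV
  · exact no_law_cube_1d7_of_onto_z4z4 hρρ hρτ hτρ hττ hρ hτ hne hsurj φ hφ h hs1 (hS ▸ hs1) hT hu7 (hU ▸ hu7) hV
  · exact no_law_cube_1d7_of_onto_z4z4 hρρ hρτ hτρ hττ hρ hτ hne hsurj φ hφ hTUS ht1 (hT ▸ ht1) hU hs7 (hS ▸ hs7)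
      hV_TUS
  · omega
  · exact no_law_cube_17e_of_onto_z4z4 hρρ hρτ hτρ hττ hρ hτ hne hsurj φ hφ hTUS ht1 (hT ▸ ht1) hu7 (hU ▸ hu7) hS
      hV_TUS
  · exact no_law_cube_17e_of_onto_z4z4 hρρ hρτ hτρ hττ hρ hτ hne hsurj φ hφ hUST hu1 (hU ▸ hu1) hs7 (hS ▸ hs7) hT
      hV_UST
  · exact no_law_cube_1d7_of_onto_z4z4 hρρ hρτ hτρ hττ hρ hτ hne hsurj φ hφ hUST hu1 (hU ▸ hu1) hS ht7 (hT ▸ ht7)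
      hV_UST
  · omega

/-- **No cube law triple with parts `1` and `3` over `A ↠ ℤ₄ × ℤ₄ (cell form)** — gen 14's `no_law_cube_13e_of_onto_z4z4` /
`no_law_cube_1d3_of_onto_z4z4` packaged like `no_law_cube_one_five_of_onto_z4z4`. [folklore] -/
theorem no_law_cube_one_three_of_onto_z4z4
    (hρρ : ∀ a b, ρ a * ρ b = ρ (a + b)) (hρτ : ∀ a b, ρ a * τ b = τ (b - a))
    (hτρ : ∀ a b, τ a * ρ b = τ (a + b)) (hττ : ∀ a b, τ a * τ b = ρ (c₀ + b - a))
    (hρ : Function.Injective ρ) (hτ : Function.Injective τ) (hne : ∀ a b, ρ a ≠ τ b)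
    (hsurj : ∀ g, (∃ a, ρ a = g) ∨ (∃ a, τ a = g))
    (φ : A →+ ZMod 4 × ZMod 4) (hφ : Function.Surjective φ)
    (h : TripleProductProperty S T U)
    (hS : (univ.filter fun a : A => ρ a ∈ S).card = (univ.filter fun a : A => τ a ∈ S).card)
    (hT : (univ.filter fun a : A => ρ a ∈ T).card = (univ.filter fun a : A => τ a ∈ T).card)
    (hU : (univ.filter fun a : A => ρ a ∈ U).card = (univ.filter fun a : A => τ a ∈ U).card)
    (h1 : (univ.filter fun a : A => ρ a ∈ S).card = 1 ∨ (univ.filter fun a : A => ρ a ∈ T).card = 1 ∨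
      (univ.filter fun a : A => ρ a ∈ U).card = 1)
    (h3 : (univ.filter fun a : A => ρ a ∈ S).card = 3 ∨ (univ.filter fun a : A => ρ a ∈ T).card = 3 ∨
      (univ.filter fun a : A => ρ a ∈ U).card = 3) :
    3 * (S.card * T.card * U.card) + 8 ≠ 8 * Fintype.card A := by
  intro hV
  have hV_TUS : 3 * (T.card * U.card * S.card) + 8 = 8 * Fintype.card A := by
    rw [show T.card * U.card * S.card = S.card * T.card * U.card by ring]; exact hV
  have hV_UST : 3 * (U.card * S.card * T.card) + 8 = 8 * Fintype.card A := by
    rw [show U.card * S.card * T.card = S.card * T.card * U.card by ring]; exact hV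
  have hTUS : TripleProductProperty T U S := h.rotate
  have hUST : TripleProductProperty U S T := h.rotate.rotate
  rcases h1 with hs1 | ht1 | hu1 <;> rcases h3 with hs3 | ht3 | hu3
  · omega
  · exact no_law_cube_13e_of_onto_z4z4 hρρ hρτ hτρ hττ hρ hτ hne hsurj φ hφ h hs1 (hS ▸ hs1) ht3 (hT ▸ ht3) hU hV
  · exact no_law_cube_1d3_of_onto_z4z4 hρρ hρτ hτρ hττ hρ hτ hne hsurj φ hφ h hs1 (hS ▸ hs1) hT hu3 (hU ▸ hu3) hV
  · exact no_law_cube_1d3_of_onto_z4z4 hρρ hρτ hτρ hττ hρ hτ hne hsurj φ hφ hTUS ht1 (hT ▸ ht1) hU hs3 (hS ▸ hs3)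
      hV_TUS
  · omega
  · exact no_law_cube_13e_of_onto_z4z4 hρρ hρτ hτρ hττ hρ hτ hne hsurj φ hφ hTUS ht1 (hT ▸ ht1) hu3 (hU ▸ hu3) hS
      hV_TUS
  · exact no_law_cube_13e_of_onto_z4z4 hρρ hρτ hτρ hττ hρ hτ hne hsurj φ hφ hUST hu1 (hU ▸ hu1) hs3 (hS ▸ hs3) hT
      hV_UST
  · exact no_law_cube_1d3_of_onto_z4z4 hρρ hρτ hτρ hττ hρ hτ hne hsurj φ hφ hUST hu1 (hU ▸ hu1) hS ht3 (hT ▸ ht3)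
      hV_UST
  · omega

/-- **No `|A| ≡ 1 (mod 3)` law over `A ↠ ℤ₄ × ℤ₄`, factorisation property with parts `3, 5, 7`**: if every factorisation
`cde = (|A| − 1)/3` has two parts `1`, or a part `1` together with a part `3`, `5` or `7`, then no dihedral-like group over `A`
(any `c₀`) has a TPP triple attaining `3|S||T||U| + 8 = 8|A|`. [folklore] -/
theorem no_mod_one_law_of_onto_z4z4_seven
    (hρρ : ∀ a b, ρ a * ρ b = ρ (a + b)) (hρτ : ∀ a b, ρ a * τ b = τ (b - a))
    (hτρ : ∀ a b, τ a * ρ b = τ (a + b)) (hττ : ∀ a b, τ a * τ b = ρ (c₀ + b - a))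
    (hρ : Function.Injective ρ) (hτ : Function.Injective τ) (hne : ∀ a b, ρ a ≠ τ b)
    (hsurj : ∀ g, (∃ a, ρ a = g) ∨ (∃ a, τ a = g)) (hA : 14 ≤ Fintype.card A)
    (φ : A →+ ZMod 4 × ZMod 4) (hφ : Function.Surjective φ)
    (hq : ∀ c d e : ℕ, 3 * (c * d * e) + 1 = Fintype.card A →
      (c = 1 ∧ d = 1) ∨ (d = 1 ∧ e = 1) ∨ (c = 1 ∧ e = 1) ∨
      ((c = 1 ∨ d = 1 ∨ e = 1) ∧ ((c = 3 ∨ d = 3 ∨ e = 3) ∨ (c = 5 ∨ d = 5 ∨ e = 5) ∨ (c = 7 ∨ d = 7 ∨ e = 7))))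
    (h : TripleProductProperty S T U) : 3 * (S.card * T.card * U.card) + 8 ≠ 8 * Fintype.card A := by
  intro hV
  have hmod : Fintype.card A % 3 = 1 := by omega
  by_cases hnc : ((univ.filter fun a : A => ρ a ∈ S).card = (univ.filter fun a : A => τ a ∈ S).card ∧
      (univ.filter fun a : A => ρ a ∈ T).card = (univ.filter fun a : A => τ a ∈ T).card ∧
      (univ.filter fun a : A => ρ a ∈ U).card = (univ.filter fun a : A => τ a ∈ U).card)
  · obtain ⟨hS', hT', hU'⟩ := hnc
    have cS := card_eq_parts' hρ hτ hne hsurj S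
    have cT := card_eq_parts' hρ hτ hne hsurj T
    have cU := card_eq_parts' hρ hτ hne hsurj U
    set s₀ := (univ.filter fun a : A => ρ a ∈ S).card with hs₀
    set t₀ := (univ.filter fun a : A => ρ a ∈ T).card with ht₀
    set u₀ := (univ.filter fun a : A => ρ a ∈ U).card with hu₀
    have eS : S.card = 2 * s₀ := by rw [cS, ← hS']; ring
    have eT : T.card = 2 * t₀ := by rw [cT, ← hT']; ring
    have eU : U.card = 2 * u₀ := by rw [cU, ← hU']; ring
    have hprod : 3 * (s₀ * t₀ * u₀) + 1 = Fintype.card A := by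
      rw [eS, eT, eU] at hV; nlinarith
    have hV_TUS : 3 * (T.card * U.card * S.card) + 8 = 8 * Fintype.card A := by
      rw [show T.card * U.card * S.card = S.card * T.card * U.card by ring]; exact hV
    have hV_UST : 3 * (U.card * S.card * T.card) + 8 = 8 * Fintype.card A := by
      rw [show U.card * S.card * T.card = S.card * T.card * U.card by ring]; exact hV
    rcases hq s₀ t₀ u₀ hprod with ⟨h1, h1'⟩ | ⟨h1, h1'⟩ | ⟨h1, h1'⟩ | ⟨h1, h3 | h5 | h7⟩
    · obtain ⟨g, a, b, hab⟩ := two_cosets_of_two_two_law hρρ hρτ hτρ hττ hρ hτ hne hsurj hmod (by omega) h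
        (by rw [eS, h1]) (by rw [eT, h1']) hV
      exact not_two_cosets_of_onto_z4z4 φ hφ g a b hab
    · obtain ⟨g, a, b, hab⟩ := two_cosets_of_two_two_law hρρ hρτ hτρ hττ hρ hτ hne hsurj hmod (by omega) h.rotate
        (by rw [eT, h1]) (by rw [eU, h1']) hV_TUS
      exact not_two_cosets_of_onto_z4z4 φ hφ g a b hab
    · obtain ⟨g, a, b, hab⟩ := two_cosets_of_two_two_law hρρ hρτ hτρ hττ hρ hτ hne hsurj hmod (by omega)
        h.rotate.rotate (by rw [eU, h1']) (by rw [eS, h1]) hV_UST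
      exact not_two_cosets_of_onto_z4z4 φ hφ g a b hab
    · exact no_law_cube_one_three_of_onto_z4z4 hρρ hρτ hτρ hττ hρ hτ hne hsurj φ hφ h hS' hT' hU' h1 h3 hV
    · exact no_law_cube_one_five_of_onto_z4z4 hρρ hρτ hτρ hττ hρ hτ hne hsurj φ hφ h hS' hT' hU' h1 h5 hV
    · exact no_law_cube_one_seven_of_onto_z4z4 hρρ hρτ hτρ hττ hρ hτ hne hsurj φ hφ h hS' hT' hU' h1 h7 hV
  · obtain ⟨g, a, b, hab⟩ :=
      two_cosets_of_mod_one_law_of_not_cube hρρ hρτ hτρ hττ hρ hτ hne hsurj hmod hA h hV hnc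
    exact not_two_cosets_of_onto_z4z4 φ hφ g a b hab

/-- `cde = 133 = 7·19`: two parts `1`, or a part `1` next to a part `7`. [folklore] -/
theorem cube_factor_17_of_400 {c d e : ℕ} (h : 3 * (c * d * e) + 1 = 400) :
    (c = 1 ∧ d = 1) ∨ (d = 1 ∧ e = 1) ∨ (c = 1 ∧ e = 1) ∨
      ((c = 1 ∨ d = 1 ∨ e = 1) ∧ ((c = 3 ∨ d = 3 ∨ e = 3) ∨ (c = 5 ∨ d = 5 ∨ e = 5) ∨ (c = 7 ∨ d = 7 ∨ e = 7))) := by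
  have hcde : c * (d * e) = 133 := by rw [← mul_assoc]; omega
  have hc : c ∈ Nat.divisors 133 := Nat.mem_divisors.2 ⟨Dvd.intro _ hcde, by norm_num⟩
  have hd : d ∈ Nat.divisors 133 :=
    Nat.mem_divisors.2 ⟨Dvd.intro (c * e) (by rw [← hcde]; ring), by norm_num⟩
  rw [show Nat.divisors 133 = {1, 7, 19, 133} from by decide] at hc hd
  simp only [Finset.mem_insert, Finset.mem_singleton] at hc hd
  rcases hc with rfl | rfl | rfl | rfl <;> rcases hd with rfl | rfl | rfl | rfl <;> omega

/-- **`|A| = 400`, `A ↠ ℤ₄ × ℤ₄` (`ℤ₄² × ℤ₂₅`, `ℤ₄² × ℤ₅²`, and the `2`-rank-`3` groups `ℤ₂² × ℤ₄ × ℤ₂₅`, `ℤ₂² × ℤ₄ × ℤ₅²`…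
containing `ℤ₄²`): no dihedral-like group over `A` (any `c₀`) attains `3|S||T||U| + 8 = 8|A|`** (`(400−1)/3 = 133 = 7·19`).
[folklore] -/
theorem no_mod_one_law_card_400_of_onto_z4z4
    (hρρ : ∀ a b, ρ a * ρ b = ρ (a + b)) (hρτ : ∀ a b, ρ a * τ b = τ (b - a))
    (hτρ : ∀ a b, τ a * ρ b = τ (a + b)) (hττ : ∀ a b, τ a * τ b = ρ (c₀ + b - a))
    (hρ : Function.Injective ρ) (hτ : Function.Injective τ) (hne : ∀ a b, ρ a ≠ τ b)
    (hsurj : ∀ g, (∃ a, ρ a = g) ∨ (∃ a, τ a = g)) (hA : Fintype.card A = 400)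
    (φ : A →+ ZMod 4 × ZMod 4) (hφ : Function.Surjective φ) (h : TripleProductProperty S T U) :
    3 * (S.card * T.card * U.card) + 8 ≠ 8 * Fintype.card A :=
  no_mod_one_law_of_onto_z4z4_seven hρρ hρτ hτρ hττ hρ hτ hne hsurj (by rw [hA]; norm_num) φ hφ
    (fun c d e hcde => cube_factor_17_of_400 (by rw [hcde, hA])) h

end DihedralLike

/-! ## Instances -/

section Instances

variable {G : Type} [Group G] [DecidableEq G] {S T U : Finset G}

open Literature.Combinatorics.Additive

/-- **`ℤ₄ × ℤ₄ × ℤ₂₅` (`≅ ℤ₄ × ℤ₁₀₀`): no dihedral-like group over it (any `c₀`; `c₀ = 0` is `Dih`) has a TPP triple with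
`3|S||T||U| + 8 = 8 · 400`** — census cell `(1,7,19)` at `400` as a kernel theorem (the whole order). [folklore] -/
theorem no_mod_one_law_z4_z4_z25 {ρ τ : ZMod 4 × (ZMod 4 × ZMod 25) → G} {c₀ : ZMod 4 × (ZMod 4 × ZMod 25)}
    (hρρ : ∀ a b, ρ a * ρ b = ρ (a + b)) (hρτ : ∀ a b, ρ a * τ b = τ (b - a))
    (hτρ : ∀ a b, τ a * ρ b = τ (a + b)) (hττ : ∀ a b, τ a * τ b = ρ (c₀ + b - a))
    (hρ : Function.Injective ρ) (hτ : Function.Injective τ) (hne : ∀ a b, ρ a ≠ τ b)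
    (hsurj : ∀ g, (∃ a, ρ a = g) ∨ (∃ a, τ a = g)) (h : TripleProductProperty S T U) :
    3 * (S.card * T.card * U.card) + 8 ≠ 8 * Fintype.card (ZMod 4 × (ZMod 4 × ZMod 25)) :=
  no_mod_one_law_card_400_of_onto_z4z4 hρρ hρτ hτρ hττ hρ hτ hne hsurj (by simp) _ (z4_z4_zn_onto_z4z4 25) h

/-- **`ℤ₄ × ℤ₄ × ℤ₅ × ℤ₅` (`≅ ℤ₂₀²`): no dihedral-like group over it (any `c₀`) has a TPP triple with
`3|S||T||U| + 8 = 8 · 400`** — census cell `(1,7,19)` at `400`, kernel. [folklore] -/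
theorem no_mod_one_law_z4_z4_z5_z5 {ρ τ : ZMod 4 × (ZMod 4 × (ZMod 5 × ZMod 5)) → G}
    {c₀ : ZMod 4 × (ZMod 4 × (ZMod 5 × ZMod 5))}
    (hρρ : ∀ a b, ρ a * ρ b = ρ (a + b)) (hρτ : ∀ a b, ρ a * τ b = τ (b - a))
    (hτρ : ∀ a b, τ a * ρ b = τ (a + b)) (hττ : ∀ a b, τ a * τ b = ρ (c₀ + b - a))
    (hρ : Function.Injective ρ) (hτ : Function.Injective τ) (hne : ∀ a b, ρ a ≠ τ b)
    (hsurj : ∀ g, (∃ a, ρ a = g) ∨ (∃ a, τ a = g)) (h : TripleProductProperty S T U) :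
    3 * (S.card * T.card * U.card) + 8 ≠ 8 * Fintype.card (ZMod 4 × (ZMod 4 × (ZMod 5 × ZMod 5))) :=
  no_mod_one_law_card_400_of_onto_z4z4 hρρ hρτ hτρ hττ hρ hτ hne hsurj (by simp)
    ((AddMonoidHom.id (ZMod 4)).prodMap (AddMonoidHom.fst (ZMod 4) (ZMod 5 × ZMod 5)))
    (fun q => ⟨(q.1, (q.2, 0)), Prod.ext rfl rfl⟩) h

/-- **Cell `(1,7,35)` at `|A| = 736`, `A = ℤ₄ × ℤ₈ × ℤ₂₃`**: no dihedral-like group over `A` (any `c₀`) has a TPP triple with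
balanced coset parts, a part `1` and a part `7`, attaining `3|S||T||U| + 8 = 8·736`. [folklore] -/
theorem z4_z8_z23_no_law_cube_one_seven {ρ τ : ZMod 4 × (ZMod 8 × ZMod 23) → G} {c₀ : ZMod 4 × (ZMod 8 × ZMod 23)}
    (hρρ : ∀ a b, ρ a * ρ b = ρ (a + b)) (hρτ : ∀ a b, ρ a * τ b = τ (b - a))
    (hτρ : ∀ a b, τ a * ρ b = τ (a + b)) (hττ : ∀ a b, τ a * τ b = ρ (c₀ + b - a))
    (hρ : Function.Injective ρ) (hτ : Function.Injective τ) (hne : ∀ a b, ρ a ≠ τ b)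
    (hsurj : ∀ g, (∃ a, ρ a = g) ∨ (∃ a, τ a = g)) (h : TripleProductProperty S T U)
    (hS : (univ.filter fun a => ρ a ∈ S).card = (univ.filter fun a => τ a ∈ S).card)
    (hT : (univ.filter fun a => ρ a ∈ T).card = (univ.filter fun a => τ a ∈ T).card)
    (hU : (univ.filter fun a => ρ a ∈ U).card = (univ.filter fun a => τ a ∈ U).card)
    (h1 : (univ.filter fun a => ρ a ∈ S).card = 1 ∨ (univ.filter fun a => ρ a ∈ T).card = 1 ∨
      (univ.filter fun a => ρ a ∈ U).card = 1)
    (h7 : (univ.filter fun a => ρ a ∈ S).card = 7 ∨ (univ.filter fun a => ρ a ∈ T).card = 7 ∨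
      (univ.filter fun a => ρ a ∈ U).card = 7) :
    3 * (S.card * T.card * U.card) + 8 ≠ 8 * Fintype.card (ZMod 4 × (ZMod 8 × ZMod 23)) :=
  no_law_cube_one_seven_of_onto_z4z4 hρρ hρτ hτρ hττ hρ hτ hne hsurj _ (z4_z8_zn_onto_z4z4 23) h hS hT hU h1 h7

end Instances

end Summit.MatrixMultiplication.OmegaCensus
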